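import Summits.CriticalPhenomena.PercolationContinuityZ3.Theorems.PercNearOneGluingNoHeavyLowerTailSahiCombTriWCorNonneg

/-!
# A boundary for the AND-product programme: the SHARED-VARIABLE conjunction of two good blocks need not be good

Support file of the one-cut programme (crux `NoHeavyLowerTail`, stmt-CriticalPhenomena-4575; unit `prim-lf-1` gen 55, memo
`FROM-prim-lf-1-gen55-TENSOR.md` §4).  The AND of two intersecting Kleitman shells on DISJOINT variable sets is conjectured to be an intersecting
Kleitman shell ((II); proved for many blocks: `…SahiCombTriWAndMaj3`, `…AndClaw`, …).  This file records, by `decide`, that the analogous statement with ONE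
SHARED variable is FALSE: for `R(x₀,x₁,y₀,y₁,c) := maj3(x₀,x₁,c) ∧ maj3(y₀,y₁,c)` (an intersecting up-set of `2^(Fin 5)`, coordinates `0,1 = x`, `2,3 = y`,
`4 = c`) one has `Cor_R(↑{3}, ↑{2}) = -2 < 0` — its section `c = 1` is `(x₀ ∨ x₁)(y₀ ∨ y₁) = K₂₂`.  So closure of goodness under products genuinely needs
the disjoint-variable (cylinder) structure.
HONEST LABEL: a decidable counterexample; no new positive result. [this work]
-/

namespace Summit.CriticalPhenomena.PercolationContinuityZ3.Theorems

namespace FiveUpSet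

open Finset

/-- `maj3(x₀,x₁,c) ∧ maj3(y₀,y₁,c)` on `Fin 5` (`x = {0,1}`, `y = {2,3}`, `c = 4`): the sets containing at least two of `{0,1,4}` and at least two of
`{2,3,4}`. [this work] -/
def sharedMaj3 : Finset (Finset (Fin 5)) :=
  univ.filter fun s => 2 ≤ (s ∩ {0, 1, 4}).card ∧ 2 ≤ (s ∩ {2, 3, 4}).card

/-- `sharedMaj3` is an up-set. [this work] -/
theorem isUpperSet_sharedMaj3 : IsUpperSet (sharedMaj3 : Set (Finset (Fin 5))) := by
  intro s t hst hs
  simp only [sharedMaj3, coe_filter, mem_univ, true_and, Set.mem_setOf_eq] at hs ⊢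
  exact ⟨hs.1.trans (card_le_card (inter_subset_inter_right hst)), hs.2.trans (card_le_card (inter_subset_inter_right hst))⟩

/-- `sharedMaj3` is antipode-free (an intersecting family). [this work] -/
theorem disjoint_sharedMaj3_refl : Disjoint sharedMaj3 (refl sharedMaj3) := by decide

/-- **The shared-variable AND of two `maj3` blocks is NOT an intersecting Kleitman shell**: `Cor` is negative on the principal up-sets `↑{3}`, `↑{2}`
(the two `y`-dictators). [this work] -/
theorem corP_sharedMaj3_neg :
    corP sharedMaj3 (univ.filter fun s => (3 : Fin 5) ∈ s) (univ.filter fun s => (2 : Fin 5) ∈ s) = -2 := by decide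

/-- Hence goodness (`Cor ≥ 0` on all pairs of up-sets) fails for `sharedMaj3`, although both factors `maj3` are good and the family is an intersecting
up-set. [this work] -/
theorem not_corP_nonneg_sharedMaj3 :
    ¬ ∀ A B : Finset (Finset (Fin 5)), IsUpperSet (A : Set (Finset (Fin 5))) → IsUpperSet (B : Set (Finset (Fin 5))) →
      0 ≤ corP sharedMaj3 A B := by
  intro h
  have hA : IsUpperSet ((univ.filter fun s : Finset (Fin 5) => (3 : Fin 5) ∈ s) : Set (Finset (Fin 5))) := by
    intro s t hst hs
    simp only [coe_filter, mem_univ, true_and, Set.mem_setOf_eq] at hs ⊢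
    exact hst hs
  have hB : IsUpperSet ((univ.filter fun s : Finset (Fin 5) => (2 : Fin 5) ∈ s) : Set (Finset (Fin 5))) := by
    intro s t hst hs
    simp only [coe_filter, mem_univ, true_and, Set.mem_setOf_eq] at hs ⊢
    exact hst hs
  have := h _ _ hA hB
  rw [corP_sharedMaj3_neg] at this
  omega

end FiveUpSet

end Summit.CriticalPhenomena.PercolationContinuityZ3.Theorems
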